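import Literature.Analysis.PDE.HopfMinimumPrinciple
import Literature.Geometry.Lorentzian.ChartLaplacian
import HarnessLib

/-!
# E. Hopf's minimum principle for `Δ_g − c` on a Riemannian manifold; positivity of
# supersolutions that are positive off a compact set (Schoen–Yau 1979, proof of Lemma 3.3)

Schoen–Yau, Comm. Math. Phys. 65 (1979), proof of Lemma 3.3 (p. 72): the solution `φ` of the
conformal equation `Δφ − Rφ/8 = 0` ((3.22)) with `φ → 1` at infinity is positive — *"Since
`R ≥ 0` … the Hopf maximum principle implies `φ > 0` on `N`."* This file proves that step for the
prelude's Laplace–Beltrami operator `g.dalembertian = tr_g Hess` of a smooth Riemannian metric on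
a manifold modelled on `ℝᴺ`, in the natural generality of E. Hopf's minimum principle for the
operator `𝔏 = −Δ_g + c`, `c ≥ 0` (López-Gómez 2012, Thm. 1.2, proved in
`Literature/Analysis/PDE/HopfMinimumPrinciple.lean` for operators `−∑ aᵢⱼ∂ᵢⱼ + ∑ bᵢ∂ᵢ + c` on open
subsets of `ℝᴺ`):

* `exists_uniformlyElliptic_of_continuousOn` — continuous, pointwise positive definite
  coefficients are uniformly elliptic on compact sets (compactness of `K × 𝕊ᴺ⁻¹`);
* `PseudoRiemannianMetric.dalembertian_supersolution_eventually_eq` — **local form on a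
  manifold**: if `φ ∈ C²(M)` satisfies `Δ_g φ ≤ c φ` with `c ≥ 0` continuous, `φ ≥ m` for a
  constant `m ≤ 0` and `φ(x⋆) = m`, then `φ = m` near `x⋆` (in the chart at `x⋆` the operator
  `−Δ_g + c` is `−∑ gⁱʲ∂ᵢⱼ + ∑ bₗ∂ₗ + c` with `bₗ = gⁱʲ Γˡᵢⱼ`, `dalembertian_eq_sum_localFrame`
  of `ChartLaplacian.lean`; its coefficients are continuous and `(gⁱʲ)` is positive definite,
  hence uniformly elliptic with bounded coefficients on a small closed ball, where López-Gómez's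
  Thm. 1.2 applies to `u = φ ∘ (chart)⁻¹`);
* `PseudoRiemannianMetric.dalembertian_supersolution_eq_of_exists_eq` — **global form**
  (López-Gómez 2012, Thm. 1.2 on a connected manifold): under the same hypotheses on a
  preconnected `M`, `φ ≡ m`;
* `PseudoRiemannianMetric.pos_of_dalembertian_le_of_pos_off_isCompact` — **positivity**
  (the step of Schoen–Yau's Lemma 3.3): on a preconnected `M`, if `Δ_g φ ≤ c φ`, `c ≥ 0`, and
  `φ > 0` off a compact set `K` with `Kᶜ ≠ ∅` (e.g. `φ → 1` along the end of an asymptotically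
  flat manifold), then `φ > 0` everywhere: otherwise `min_K φ = min_M φ = m ≤ 0` is attained and
  `φ ≡ m ≤ 0`, contradicting positivity off `K`.

Everything is proved; there are no definitions and no named facts.

## References

* R. Schoen, S.-T. Yau, *On the proof of the positive mass conjecture in general relativity*,
  Comm. Math. Phys. 65 (1979) 45–76, proof of Lemma 3.3 (p. 72).
* J. López-Gómez, *Linear Second Order Elliptic Operators*, World Scientific (2012; © 2013),
  Ch. 1, Thm. 1.2 (minimum principle of E. Hopf).
* D. Gilbarg, N. S. Trudinger, *Elliptic Partial Differential Equations of Second Order*,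
  Springer 2001, Thm. 3.5.
* B. O'Neill, *Semi-Riemannian geometry*, Academic Press 1983, Ch. 3, Def. 3.50 ff. (the
  Laplacian in coordinates).
-/

noncomputable section

open Bundle Set Function Filter Manifold Metric
open scoped Manifold ContDiff Topology Matrix

namespace Literature.Geometry.Lorentzian

open Literature.Analysis.PDE

/-! ### Uniform ellipticity from pointwise ellipticity -/

section Algebra

variable {N : ℕ}

/-- Homogeneity of the quadratic form of a coefficient array. [folklore] -/
private theorem quadForm_smul (a : Fin N → Fin N → ℝ) (s : ℝ) (η : Fin N → ℝ) :
    ∑ i, ∑ j, a i j * (s * η i) * (s * η j) = s ^ 2 * ∑ i, ∑ j, a i j * η i * η j := by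
  rw [Finset.mul_sum]
  refine Finset.sum_congr rfl fun i _ ↦ ?_
  rw [Finset.mul_sum]
  refine Finset.sum_congr rfl fun j _ ↦ ?_
  ring

/-- A single entry is bounded by the sum of the absolute values of all entries. [folklore] -/
private theorem abs_entry_le_sum₂ (a : Fin N → Fin N → ℝ) (i j : Fin N) :
    |a i j| ≤ ∑ i', ∑ j', |a i' j'| := by
  calc |a i j| ≤ ∑ j', |a i j'| :=
        Finset.single_le_sum (f := fun j' ↦ |a i j'|) (fun _ _ ↦ abs_nonneg _) (Finset.mem_univ j)
    _ ≤ ∑ i', ∑ j', |a i' j'| :=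
        Finset.single_le_sum (f := fun i' ↦ ∑ j', |a i' j'|)
          (fun _ _ ↦ Finset.sum_nonneg fun _ _ ↦ abs_nonneg _) (Finset.mem_univ i)

/-- A single entry is bounded by the sum of the absolute values of all entries. [folklore] -/
private theorem abs_entry_le_sum₁ (b : Fin N → ℝ) (i : Fin N) : |b i| ≤ ∑ i', |b i'| :=
  Finset.single_le_sum (f := fun i' ↦ |b i'|) (fun _ _ ↦ abs_nonneg _) (Finset.mem_univ i)

/-- Rearranging the chart expression `∑ᵢⱼ aᵢⱼ (Uᵢⱼ − ∑ₗ Γᵢⱼₗ U'ₗ)` of the Laplace–Beltrami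
operator into the form `∑ᵢⱼ aᵢⱼ Uᵢⱼ − ∑ₗ bₗ U'ₗ`, `bₗ = ∑ᵢⱼ aᵢⱼ Γᵢⱼₗ`, of a linear second order
operator. [folklore] -/
private theorem sum_mul_sub_sum_eq (a U : Fin N → Fin N → ℝ) (Γ : Fin N → Fin N → Fin N → ℝ)
    (U' : Fin N → ℝ) :
    ∑ i, ∑ j, a i j * (U i j - ∑ l, Γ i j l * U' l) =
      ∑ i, ∑ j, a i j * U i j - ∑ l, (∑ i, ∑ j, a i j * Γ i j l) * U' l := by
  have h1 : ∑ i, ∑ j, a i j * (U i j - ∑ l, Γ i j l * U' l) =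
      ∑ i, ∑ j, a i j * U i j - ∑ i, ∑ j, ∑ l, a i j * Γ i j l * U' l := by
    rw [← Finset.sum_sub_distrib]
    refine Finset.sum_congr rfl fun i _ ↦ ?_
    rw [← Finset.sum_sub_distrib]
    refine Finset.sum_congr rfl fun j _ ↦ ?_
    rw [mul_sub, Finset.mul_sum]
    refine congrArg _ (Finset.sum_congr rfl fun l _ ↦ ?_)
    ring
  have h2 : ∑ l, (∑ i, ∑ j, a i j * Γ i j l) * U' l = ∑ i, ∑ j, ∑ l, a i j * Γ i j l * U' l := by
    simp_rw [Finset.sum_mul]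
    rw [Finset.sum_comm]
    refine Finset.sum_congr rfl fun i _ ↦ ?_
    rw [Finset.sum_comm]
  rw [h1, h2]

/-- The quadratic form of a real matrix: `x ⬝ᵥ (A *ᵥ x) = ∑ᵢⱼ Aᵢⱼ xᵢ xⱼ`. [folklore] -/
private theorem dotProduct_mulVec_eq_sum (A : Matrix (Fin N) (Fin N) ℝ) (x : Fin N → ℝ) :
    x ⬝ᵥ (A *ᵥ x) = ∑ i, ∑ j, A i j * x i * x j := by
  simp only [dotProduct, Matrix.mulVec, Finset.mul_sum]
  refine Finset.sum_congr rfl fun i _ ↦ Finset.sum_congr rfl fun j _ ↦ ?_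
  ring

/-- **Uniform ellipticity on compact sets.** If the coefficients `aᵢⱼ` are continuous on a
compact set `K ⊆ ℝᴺ` and pointwise positive definite there (`∑ aᵢⱼ(x) ξᵢ ξⱼ > 0` for `ξ ≠ 0`),
then they are uniformly elliptic on `K`: `∑ aᵢⱼ(x) ξᵢ ξⱼ ≥ μ |ξ|²` with one `μ > 0` (the
continuous positive function `(x, ξ) ↦ ∑ aᵢⱼ(x) ξᵢ ξⱼ` attains its minimum on the compact set
`K × 𝕊ᴺ⁻¹`; homogeneity). Gilbarg–Trudinger 2001, Ch. 3, p. 31 (locally uniformly elliptic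
operators). [folklore] -/
theorem exists_uniformlyElliptic_of_continuousOn {K : Set (EuclideanSpace ℝ (Fin N))}
    (hK : IsCompact K) {a : EuclideanSpace ℝ (Fin N) → Fin N → Fin N → ℝ}
    (hac : ∀ i j, ContinuousOn (fun x ↦ a x i j) K)
    (hpos : ∀ x ∈ K, ∀ ξ : EuclideanSpace ℝ (Fin N), ξ ≠ 0 → 0 < ∑ i, ∑ j, a x i j * ξ i * ξ j) :
    ∃ μ : ℝ, 0 < μ ∧ ∀ x ∈ K, ∀ ξ : EuclideanSpace ℝ (Fin N),
      μ * ‖ξ‖ ^ 2 ≤ ∑ i, ∑ j, a x i j * ξ i * ξ j := by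
  set Q : EuclideanSpace ℝ (Fin N) × EuclideanSpace ℝ (Fin N) → ℝ := fun p ↦
    ∑ i, ∑ j, a p.1 i j * p.2 i * p.2 j with hQ
  by_cases hne : (K ×ˢ sphere (0 : EuclideanSpace ℝ (Fin N)) 1).Nonempty
  · have hQc : ContinuousOn Q (K ×ˢ sphere 0 1) := by
      refine continuousOn_finsetSum _ fun i _ ↦ continuousOn_finsetSum _ fun j _ ↦ ?_
      have h1 : ContinuousOn (fun p : EuclideanSpace ℝ (Fin N) × EuclideanSpace ℝ (Fin N) ↦
          a p.1 i j) (K ×ˢ sphere 0 1) :=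
        (hac i j).comp continuousOn_fst fun p hp ↦ hp.1
      have h2 : ∀ k, Continuous fun p : EuclideanSpace ℝ (Fin N) × EuclideanSpace ℝ (Fin N) ↦
          p.2 k := fun k ↦ by fun_prop
      exact (h1.mul (h2 i).continuousOn).mul (h2 j).continuousOn
    obtain ⟨p₀, hp₀, hminQ⟩ := (hK.prod (isCompact_sphere 0 1)).exists_isMinOn hne hQc
    have hp₀2 : p₀.2 ≠ 0 := by
      intro h
      have := mem_sphere_zero_iff_norm.mp hp₀.2
      rw [h, norm_zero] at this
      exact zero_ne_one this
    refine ⟨Q p₀, hpos p₀.1 hp₀.1 _ hp₀2, fun x hx ξ ↦ ?_⟩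
    by_cases hξ : ξ = 0
    · subst hξ; simp
    · have hnξ : 0 < ‖ξ‖ := norm_pos_iff.mpr hξ
      set η : EuclideanSpace ℝ (Fin N) := ‖ξ‖⁻¹ • ξ with hη
      have hηS : η ∈ sphere (0 : EuclideanSpace ℝ (Fin N)) 1 := by
        rw [mem_sphere_zero_iff_norm, hη, norm_smul, norm_inv, norm_norm,
          inv_mul_cancel₀ hnξ.ne']
      have hmin : Q p₀ ≤ Q (x, η) := hminQ ⟨hx, hηS⟩
      have hQη : Q (x, η) = ‖ξ‖⁻¹ ^ 2 * ∑ i, ∑ j, a x i j * ξ i * ξ j := by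
        simp only [hQ, hη, PiLp.smul_apply, smul_eq_mul]
        exact quadForm_smul _ _ _
      rw [hQη] at hmin
      have h2 : Q p₀ * ‖ξ‖ ^ 2 ≤ ‖ξ‖⁻¹ ^ 2 * (∑ i, ∑ j, a x i j * ξ i * ξ j) * ‖ξ‖ ^ 2 :=
        mul_le_mul_of_nonneg_right hmin (by positivity)
      calc Q p₀ * ‖ξ‖ ^ 2 ≤ ‖ξ‖⁻¹ ^ 2 * (∑ i, ∑ j, a x i j * ξ i * ξ j) * ‖ξ‖ ^ 2 := h2
        _ = ∑ i, ∑ j, a x i j * ξ i * ξ j := by field_simp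
  · refine ⟨1, one_pos, fun x hx ξ ↦ ?_⟩
    have hξ : ξ = 0 := by
      by_contra hξ
      have hnξ : 0 < ‖ξ‖ := norm_pos_iff.mpr hξ
      refine hne ⟨(x, ‖ξ‖⁻¹ • ξ), hx, ?_⟩
      rw [mem_sphere_zero_iff_norm, norm_smul, norm_inv, norm_norm, inv_mul_cancel₀ hnξ.ne']
    subst hξ; simp

end Algebra

/-! ### E. Hopf's minimum principle for `Δ_g − c` on a manifold -/

namespace PseudoRiemannianMetric

variable {N : ℕ} {M : Type*} [TopologicalSpace M] [ChartedSpace (EuclideanSpace ℝ (Fin N)) M]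
  [IsManifold (𝓡 N) ∞ M]
  (g : PseudoRiemannianMetric (𝓡 N) ∞ (EuclideanSpace ℝ (Fin N)) (TangentSpace (𝓡 N) : M → Type _))
  [g.HasLeviCivita]

/-- **E. Hopf's minimum principle for `−Δ_g + c` on a Riemannian manifold, local form.** Let `g`
be a smooth Riemannian metric on a manifold `M` modelled on `ℝᴺ`, `c ≥ 0` continuous, and
`φ ∈ C²(M)` a supersolution, `Δ_g φ ≤ c φ` (`Δ_g = tr_g Hess`, the prelude's `dalembertian`). If
`φ ≥ m` for a constant `m ≤ 0` and `φ(x⋆) = m`, then `φ = m` on a neighbourhood of `x⋆`. In the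
chart at `x⋆`, with `u = φ ∘ (chart)⁻¹` and metric coefficients `Ĝ`,
`Δ_g φ = ∑ Ĝⁱʲ (∂ᵢⱼu − Γˡᵢⱼ ∂ₗu)` (`dalembertian_eq_sum_localFrame`), so `u` is a supersolution of
`𝔏 = −∑ Ĝⁱʲ∂ᵢⱼ + ∑ (ĜⁱʲΓˡᵢⱼ) ∂ₗ + c`, whose coefficients are continuous, with `(Ĝⁱʲ)` positive
definite (`g` is Riemannian) — hence uniformly elliptic with bounded coefficients on a closed
ball (`exists_uniformlyElliptic_of_continuousOn`) —, and López-Gómez's Thm. 1.2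
(`hopf_minimumPrinciple_eventually_eq`) applies. Schoen–Yau 1979 invoke exactly this ("the Hopf
maximum principle implies `φ > 0`", p. 72). [cite: LopezGomez2012, Thm. 1.2]
[cite: SchoenYauPMT1979, proof of Lemma 3.3 (p. 72)] -/
theorem dalembertian_supersolution_eventually_eq (hg : g.IsRiemannian) {c φ : M → ℝ}
    (hc : Continuous c) (hc0 : ∀ x, 0 ≤ c x) (hφ : ContMDiff (𝓡 N) 𝓘(ℝ) 2 φ)
    (hpde : ∀ x, g.dalembertian φ x ≤ c x * φ x) {m : ℝ} (hm : m ≤ 0) (hmin : ∀ x, m ≤ φ x)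
    {x₀ : M} (hx₀ : φ x₀ = m) : ∀ᶠ x in 𝓝 x₀, φ x = m := by
  classical
  -- the chart at `x₀`, its target `T`, the standard basis `b` of `ℝᴺ`
  set ψ := extChartAt (𝓡 N) x₀ with hψ
  set T : Set (EuclideanSpace ℝ (Fin N)) := ψ.target with hT
  have hTo : IsOpen T := isOpen_extChartAt_target x₀
  have hx₀s : x₀ ∈ ψ.source := mem_extChartAt_source x₀
  have hz₀T : ψ x₀ ∈ T := ψ.map_source hx₀s
  set b : Module.Basis (Fin N) ℝ (EuclideanSpace ℝ (Fin N)) :=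
    (EuclideanSpace.basisFun (Fin N) ℝ).toBasis with hb
  have hbi : ∀ i, b i = EuclideanSpace.single i 1 := fun i ↦ by
    rw [hb, OrthonormalBasis.coe_toBasis, EuclideanSpace.basisFun_apply]
  -- representatives: metric coefficients `Gf`, inverse `A`, Christoffel-type `Γ`, `B`, `cc`, `u`
  set Fr := (trivializationAt (EuclideanSpace ℝ (Fin N)) (TangentSpace (𝓡 N)) x₀).localFrame b
    with hFr
  set Gf : EuclideanSpace ℝ (Fin N) → Fin N → Fin N → ℝ := fun y i j ↦
    g.val (ψ.symm y) (Fr i (ψ.symm y)) (Fr j (ψ.symm y)) with hGf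
  set A : EuclideanSpace ℝ (Fin N) → Matrix (Fin N) (Fin N) ℝ := fun y ↦ (Matrix.of (Gf y))⁻¹
    with hA
  set Γ : EuclideanSpace ℝ (Fin N) → Fin N → Fin N → Fin N → ℝ := fun y i j l ↦
    ∑ k, 2⁻¹ * (fderiv ℝ (fun z ↦ Gf z j k) y (b i) + fderiv ℝ (fun z ↦ Gf z i k) y (b j) -
      fderiv ℝ (fun z ↦ Gf z i j) y (b k)) * A y k l with hΓ
  set B : EuclideanSpace ℝ (Fin N) → Fin N → ℝ := fun y l ↦ ∑ i, ∑ j, A y i j * Γ y i j l with hB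
  set cc : EuclideanSpace ℝ (Fin N) → ℝ := fun y ↦ c (ψ.symm y) with hcc
  set u : EuclideanSpace ℝ (Fin N) → ℝ := φ ∘ ψ.symm with hu
  -- (1) the equation in the chart: `𝔏 u = -Δ_g φ + c φ ≥ 0` on `T`
  have hsrc : ∀ y ∈ T, ψ.symm y ∈ (chartAt (EuclideanSpace ℝ (Fin N)) x₀).source := fun y hy ↦ by
    rw [← extChartAt_source (𝓡 N)]
    exact ψ.map_target hy
  have hΔ : ∀ y ∈ T, g.dalembertian φ (ψ.symm y) =
      ∑ i, ∑ j, A y i j * (fderiv ℝ (fderiv ℝ u) y (b i) (b j) -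
        ∑ l, Γ y i j l * fderiv ℝ u y (b l)) := by
    intro y hy
    have h := dalembertian_eq_sum_localFrame g b (hsrc y hy) (hφ _)
      (Gh := Gf) (Eventually.of_forall fun z i j ↦ rfl) (fh := u) Filter.EventuallyEq.rfl
    rw [ψ.right_inv hy] at h
    exact h
  have hLu : ∀ y ∈ T, 0 ≤ -(∑ i, ∑ j, A y i j * fderiv ℝ (fderiv ℝ u) y
      (EuclideanSpace.single i 1) (EuclideanSpace.single j 1)) +
      ∑ l, B y l * fderiv ℝ u y (EuclideanSpace.single l 1) + cc y * u y := by
    intro y hy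
    have h1 := hΔ y hy
    rw [sum_mul_sub_sum_eq] at h1
    simp only [hbi] at h1
    have h2 := hpde (ψ.symm y)
    rw [h1] at h2
    have h3 : cc y * u y = c (ψ.symm y) * φ (ψ.symm y) := rfl
    rw [h3]
    linarith
  -- (2) pointwise ellipticity: `A = Ĝ⁻¹` is positive definite on `T`
  have hApos : ∀ y ∈ T, ∀ ξ : EuclideanSpace ℝ (Fin N), ξ ≠ 0 →
      0 < ∑ i, ∑ j, A y i j * ξ i * ξ j := by
    intro y hy ξ hξ
    have hpe : ψ.symm y ∈
        (trivializationAt (EuclideanSpace ℝ (Fin N)) (TangentSpace (𝓡 N)) x₀).baseSet := by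
      simpa using hsrc y hy
    set β := (trivializationAt (EuclideanSpace ℝ (Fin N)) (TangentSpace (𝓡 N)) x₀).basisAt b hpe
      with hβ
    have hFrβ : ∀ i, Fr i (ψ.symm y) = β i := fun i ↦
      Trivialization.localFrame_apply_of_mem_baseSet _ b hpe
    have hGpos : (Matrix.of (Gf y)).PosDef := by
      refine Matrix.PosDef.of_dotProduct_mulVec_pos ?_ fun x hx ↦ ?_
      · ext i j
        simp only [Matrix.conjTranspose_apply, Matrix.of_apply, star_trivial, hGf]
        exact g.symm _ _ _
      · have h : star x ⬝ᵥ ((Matrix.of (Gf y)) *ᵥ x) =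
            g.val (ψ.symm y) (∑ i, x i • β i) (∑ j, x j • β j) := by
          rw [star_trivial, dotProduct_mulVec_eq_sum]
          simp only [Matrix.of_apply, hGf, hFrβ, map_sum, map_smul,
            _root_.sum_apply, _root_.smul_apply, smul_eq_mul,
            Finset.mul_sum]
          refine Finset.sum_congr rfl fun i _ ↦ Finset.sum_congr rfl fun j _ ↦ ?_
          rw [g.symm _ (β j) (β i)]
          ring
        rw [h]
        refine hg _ _ fun h0 ↦ hx ?_
        funext i
        exact Fintype.linearIndependent_iff.1 β.linearIndependent x h0 i
    have hAy : (A y).PosDef := hGpos.inv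
    have hx : (ξ : Fin N → ℝ) ≠ 0 := fun h ↦ hξ (by
      ext i
      exact congrFun h i)
    have := hAy.dotProduct_mulVec_pos hx
    rwa [star_trivial, dotProduct_mulVec_eq_sum] at this
  -- (3) continuity of the coefficients on `T`
  have hGs : ∀ i j, ContDiffOn ℝ ∞ (fun y ↦ Gf y i j) T := fun i j ↦
    contDiffOn_gram_comp_extChartAt_symm b g i j
  have hAc : ∀ i j, ContinuousOn (fun y ↦ A y i j) T := by
    intro i j y hy
    have h := contMDiffAt_matrix_inv (I := 𝓘(ℝ, EuclideanSpace ℝ (Fin N))) (k := ∞)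
      (A := fun y ↦ Matrix.of (Gf y)) (x₀ := y)
      (fun i j ↦ contMDiffAt_iff_contDiffAt.2 ((hGs i j).contDiffAt (hTo.mem_nhds hy)))
      (det_gram_comp_extChartAt_symm_ne_zero b g hy) i j
    exact (contMDiffAt_iff_contDiffAt.1 h).continuousAt.continuousWithinAt
  have hdG : ∀ i j (v : EuclideanSpace ℝ (Fin N)),
      ContinuousOn (fun y ↦ fderiv ℝ (fun z ↦ Gf z i j) y v) T := fun i j v ↦
    ((hGs i j).continuousOn_fderiv_of_isOpen hTo (by simp)).clm_apply continuousOn_const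
  have hΓc : ∀ i j l, ContinuousOn (fun y ↦ Γ y i j l) T := fun i j l ↦
    continuousOn_finsetSum _ fun k _ ↦
      (continuousOn_const.mul (((hdG j k (b i)).add (hdG i k (b j))).sub (hdG i j (b k)))).mul
        (hAc k l)
  have hBc : ∀ l, ContinuousOn (fun y ↦ B y l) T := fun l ↦
    continuousOn_finsetSum _ fun i _ ↦ continuousOn_finsetSum _ fun j _ ↦
      (hAc i j).mul (hΓc i j l)
  have hccc : ContinuousOn cc T := hc.comp_continuousOn (continuousOn_extChartAt_symm x₀)
  have huC2 : ContDiffOn ℝ 2 u T := contDiffOn_comp_extChartAt_symm hφ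
  -- (4) a closed ball `K ⊆ T` around `ψ x₀`; bounds and uniform ellipticity on `K`
  obtain ⟨r, hr, hrT⟩ := nhds_basis_closedBall.mem_iff.mp (hTo.mem_nhds hz₀T)
  set K : Set (EuclideanSpace ℝ (Fin N)) := closedBall (ψ x₀) r with hK
  have hKc : IsCompact K := isCompact_closedBall _ _
  have hS : ContinuousOn (fun y ↦ ∑ i, ∑ j, |A y i j| + ∑ l, |B y l| + |cc y|) K := by
    refine ((continuousOn_finsetSum _ fun i _ ↦ continuousOn_finsetSum _ fun j _ ↦
      continuous_abs.comp_continuousOn ((hAc i j).mono hrT)).add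
      (continuousOn_finsetSum _ fun l _ ↦
        continuous_abs.comp_continuousOn ((hBc l).mono hrT))).add
      (continuous_abs.comp_continuousOn (hccc.mono hrT))
  obtain ⟨C, hC⟩ := hKc.exists_bound_of_continuousOn hS
  have hbdK : ∀ y ∈ K, (∀ i j, |A y i j| ≤ C) ∧ (∀ l, |B y l| ≤ C) ∧ |cc y| ≤ C := by
    intro y hy
    have h := (le_abs_self _).trans (Real.norm_eq_abs _ ▸ hC y hy)
    have h1 : 0 ≤ ∑ i, ∑ j, |A y i j| :=
      Finset.sum_nonneg fun _ _ ↦ Finset.sum_nonneg fun _ _ ↦ abs_nonneg _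
    have h2 : 0 ≤ ∑ l, |B y l| := Finset.sum_nonneg fun _ _ ↦ abs_nonneg _
    have h3 := abs_nonneg (cc y)
    exact ⟨fun i j ↦ by linarith [abs_entry_le_sum₂ (A y) i j],
      fun l ↦ by linarith [abs_entry_le_sum₁ (B y) l], by linarith⟩
  obtain ⟨μ, hμ, hellK⟩ := exists_uniformlyElliptic_of_continuousOn hKc
    (a := fun y i j ↦ A y i j) (fun i j ↦ (hAc i j).mono hrT)
    (fun y hy ξ hξ ↦ hApos y (hrT hy) ξ hξ)
  -- (5) E. Hopf's minimum principle on the open ball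
  have hbT : ball (ψ x₀) r ⊆ T := ball_subset_closedBall.trans hrT
  have key := hopf_minimumPrinciple_eventually_eq (Ω := ball (ψ x₀) r) isOpen_ball
    (a := fun y i j ↦ A y i j) (b := B) (c := cc) (u := u) (μ := μ) (m := m)
    (fun y hy i j ↦ by
      have hGsy : (Matrix.of (Gf y)).IsSymm :=
        Matrix.IsSymm.ext fun i j ↦ by simp only [Matrix.of_apply, hGf, g.symm _]
      exact (hGsy.inv.apply i j).symm)
    hμ (fun y hy ξ ↦ hellK y (ball_subset_closedBall hy) ξ)
    (fun K' hK' _ ↦ ⟨C, fun y hy ↦ hbdK y (ball_subset_closedBall (hK' hy))⟩)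
    (fun y _ ↦ hc0 _) (huC2.mono hbT) (fun y hy ↦ hLu y (hbT hy)) hm
    (fun y _ ↦ hmin _) (mem_ball_self hr)
    (by simp only [hu, Function.comp_apply, ψ.left_inv hx₀s, hx₀])
  -- (6) back to the manifold
  have hev : ∀ᶠ x in 𝓝 x₀, u (ψ x) = m := (continuousAt_extChartAt x₀).eventually key
  filter_upwards [hev, extChartAt_source_mem_nhds (I := 𝓡 N) x₀] with x hx hxs
  simpa only [hu, Function.comp_apply, ψ.left_inv hxs] using hx

/-- **E. Hopf's minimum principle for `−Δ_g + c` on a connected Riemannian manifold**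
(López-Gómez 2012, Thm. 1.2, globalised): `g` smooth Riemannian, `c ≥ 0` continuous,
`φ ∈ C²(M)` with `Δ_g φ ≤ c φ` and `φ ≥ m` for a constant `m ≤ 0` on a preconnected `M`. If
`φ(x⋆) = m` at one point then `φ ≡ m` (the coincidence set is open by
`dalembertian_supersolution_eventually_eq`, closed by continuity). [cite: LopezGomez2012, Thm. 1.2] -/
theorem dalembertian_supersolution_eq_of_exists_eq [PreconnectedSpace M] (hg : g.IsRiemannian)
    {c φ : M → ℝ} (hc : Continuous c) (hc0 : ∀ x, 0 ≤ c x) (hφ : ContMDiff (𝓡 N) 𝓘(ℝ) 2 φ)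
    (hpde : ∀ x, g.dalembertian φ x ≤ c x * φ x) {m : ℝ} (hm : m ≤ 0) (hmin : ∀ x, m ≤ φ x)
    {x₀ : M} (hx₀ : φ x₀ = m) : ∀ x, φ x = m := by
  set S : Set M := {x | φ x = m} with hS
  have hSo : IsOpen S := by
    rw [isOpen_iff_mem_nhds]
    intro x hx
    exact g.dalembertian_supersolution_eventually_eq hg hc hc0 hφ hpde hm hmin hx
  have hSc : IsClosed S := isClosed_eq hφ.continuous continuous_const
  have hcl : IsClopen S := ⟨hSc, hSo⟩
  rcases isClopen_iff.mp hcl with h | h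
  · exact absurd (show x₀ ∈ S from hx₀) (by simp [h])
  · exact fun x ↦ (show x ∈ S by simp [h])

/-- **Positivity of supersolutions that are positive off a compact set** — the step
*"the Hopf maximum principle implies `φ > 0` on `N`"* of Schoen–Yau 1979, proof of Lemma 3.3
(p. 72; there `Δφ = Rφ/8`, `R ≥ 0`, and `φ → 1` along the asymptotically flat end, so that
`φ > 0` outside a compact set). Let `g` be a smooth Riemannian metric on a preconnected manifold
`M` modelled on `ℝᴺ`, `c ≥ 0` continuous, `φ ∈ C²(M)` with `Δ_g φ ≤ c φ`, and suppose `φ > 0`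
off a compact set `K` whose complement is nonempty. Then `φ > 0` everywhere. (Otherwise
`m = min_K φ ≤ 0` is the minimum of `φ` on `M` and is attained, so `φ ≡ m ≤ 0` by
`dalembertian_supersolution_eq_of_exists_eq`, contradicting `φ > 0` at a point of `Kᶜ`. The
printed proof obtains `φ ≥ 0` from the Sobolev inequality (Lemma 3.1) first; the minimum
principle gives both steps.) [cite: SchoenYauPMT1979, proof of Lemma 3.3 (p. 72)]
[cite: LopezGomez2012, Thm. 1.2] -/
theorem pos_of_dalembertian_le_of_pos_off_isCompact [PreconnectedSpace M] (hg : g.IsRiemannian)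
    {c φ : M → ℝ} (hc : Continuous c) (hc0 : ∀ x, 0 ≤ c x) (hφ : ContMDiff (𝓡 N) 𝓘(ℝ) 2 φ)
    (hpde : ∀ x, g.dalembertian φ x ≤ c x * φ x) {K : Set M} (hK : IsCompact K)
    (hpos : ∀ x, x ∉ K → 0 < φ x) (hne : Kᶜ.Nonempty) : ∀ x, 0 < φ x := by
  by_contra! hcon
  obtain ⟨x₁, hx₁⟩ := hcon
  have hx₁K : x₁ ∈ K := by
    by_contra h
    exact absurd (hpos x₁ h) (not_lt.mpr hx₁)
  obtain ⟨x₀, hx₀K, hx₀min⟩ :=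
    hK.exists_isMinOn ⟨x₁, hx₁K⟩ hφ.continuous.continuousOn
  set m : ℝ := φ x₀ with hm
  have hm0 : m ≤ 0 := (hx₀min hx₁K).trans hx₁
  have hmin : ∀ x, m ≤ φ x := fun x ↦ by
    by_cases hx : x ∈ K
    · exact hx₀min hx
    · exact hm0.trans (hpos x hx).le
  have hall := g.dalembertian_supersolution_eq_of_exists_eq hg hc hc0 hφ hpde hm0 hmin
    (x₀ := x₀) rfl
  obtain ⟨x₂, hx₂⟩ := hne
  have h1 := hpos x₂ hx₂
  rw [hall x₂] at h1
  exact absurd hm0 (not_le.mpr h1)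

end PseudoRiemannianMetric

end Literature.Geometry.Lorentzian

end
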